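import Literature.MathematicalPhysics.QuantumFieldTheory.Balaban1983to89.Node00.DressedSlotsOfRecord12
import Literature.MathematicalPhysics.QuantumFieldTheory.Balaban1983to89.Node00.Record13

/-!
# NODE 00 — THE DRESSED SLOT FAMILY OF RECORD RE-KEYED AT STAGE 13: F3's dressed (2.18) slots ∕ densities ∕ class weights (typed over the Stage-9 part of
# the tuple in the ₁₂ module) specialised AT THE STAGE-13 RECORD `Node00.datumOfRecord₁₃` — E1 at level 0 at the ₁₃ record as a SUM identity with NO hypothesis

Cell `pub-ymgap`, YM-PLAN Track A (HUMAN RULING D-0062); author seat `pub-ymgap-dag-n20-d` (generation 4), the live seat of the N20 lineage, on director-ym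
LINE №125 «RECORD 13» and node00-def-RR-2's `R13-KEY-TOKEN-MAP.md` («n20-d pens» the ₁₂ → ₁₃ of its modules).  The ₁₃ RE-KEY of §2 of this seat's
`Node00/DressedSlotsOfRecord12.lean` (p464367), whose §1 (the dressed objects typed over `ϑ : Stage9Params` — `dressedSlotsOfDatum₉`, `dressedDensityOfDatum₉`,
`classWeightOfDatum₉`, `sum_classWeightOfDatum₉_zero`) is imported and read BY NAME.  [III] = [Balaban1988Convergent], [IV] = [Balaban1989LargeFieldI].

WHY.  def-T's Record 13 (`Node00/Record13.lean`, p486037) re-instantiates the Stage-12 record at the suffix `₁₃` over `Node00.Stage13Params F N`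
(`extends Stage12Params` by one numeric letter; three proviso rows re-pointed; NO transport field).  There is no ₁₂ ↔ ₁₃ bridge (RR-2's map §3), so the
record-keyed dressed objects are re-typed at `(θ : Stage13Params F N) (hP : θ.Provisos₁₃ F N)` through `θ.toStage9Params` and `Node00.datumOfRecord₁₃ F N θ hP`,
where B1 holds by def-T's `isPrintedAveraged_datumOfRecord₁₃` — so that E1 AT LEVEL 0 is a theorem AT THE ₁₃ RECORD with no hypothesis
(`sum_classWeightOfRecord₁₃_zero`), exactly as at ₁₂.

WHAT IS DEFINED ∕ PROVED (definitions of record + `rfl`-grade faces; the ₁₂ module's §2 with `12 ↦ 13`).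
`integrable_dressedStart_datumOfRecord₁₃` (NO hypothesis) · `dressedSlotsOfRecord₁₃ θ hP` · `dressedSlotsOfRecord₁₃_eq` · `dressedSlotsOfRecord₁₃_zero` ·
`dressedDensityOfRecord₁₃` · `dressedDensityOfRecord₁₃_zero` · `integral_dressedDensityOfRecord₁₃_zero` · `classWeightOfRecord₁₃` ·
**`sum_classWeightOfRecord₁₃_zero`** (E1 AT LEVEL 0 AT THE STAGE-13 RECORD, NO hypothesis).

HONEST FRAMING — what this is NOT.  OBJECTS and `rfl`-grade faces only.  E1 BEYOND LEVEL 0, the (0.4) telescoping on the dressed family and node U5d's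
run-B truncation are NOT here (F3's header locates them).  No bad set, no shell split, no weight slot (the Summits-side READING's, `YMDAG.UVSplit.SpineReading₁₃`).
Nothing of Bałaban's is asserted; no inhabitant of `IsRecordOfRecord₁₃C` is claimed (K0‴ open); no node count moves (typed 28∕28 · discharged 5∕28);
`--supports` K0′ (stmt-QuantumFields-19902) as a NODE 00 object module.  No `sorry`, no `axiom`, no `opaque`, no `instance`, no `notation`, no attribute
removed.  One finite four-torus programme at fixed `ε` — NOT the continuum limit on ℝ⁴, NOT infinite volume, NOT OS, NOT a mass gap, NOT the Clay problem.
-/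

noncomputable section

open MeasureTheory

namespace Literature.MathematicalPhysics.QuantumFieldTheory.Balaban1983to89.Node00

open T4Continuum

variable (F : T4Family) (N : ℕ) [NeZero N]

/-! ## At the Stage-13 record `Node00.datumOfRecord₁₃ F N θ hP` -/

/-- **THE DRESSED START IS INTEGRABLE AT EVERY STAGE-13 DATUM OF RECORD — NO hypothesis** (B1: def-T's `isPrintedAveraged_datumOfRecord₁₃` ⇒ `AvgMeasurable`;
then F3 `integrable_dressedStart`). [cite: Balaban1989LargeFieldII, Thm 1 p.355 (bookkeeping)] -/
theorem integrable_dressedStart_datumOfRecord₁₃ (θ : Stage13Params F N) (hP : θ.Provisos₁₃ F N) (g₀ : ℕ → ℝ) (os : List (ULoop F)) (t : ℝ)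
    (p : B12.RunParams) :
    Integrable (dressedStart F N (datumOfRecord₁₃ F N θ hP) g₀ os t p) (fieldMeasure (F.P p.K) 0 (SU N)) :=
  integrable_dressedStart F N _ (isPrintedAveraged_datumOfRecord₁₃ F N θ hP).avgMeasurable g₀ os t p

/-- **THE DRESSED SLOT FAMILY OF RECORD, STAGE 13**: the Stage-9 part of an admissible-with-provisos Stage-13 tuple supplies the STEPS, its own datum of record
`datumOfRecord₁₃ F N θ hP` the START. [cite: Balaban1988Convergent, (2.18) p.257; Balaban1989LargeFieldII, Thm 1 + (0.1) pp.355–356 (bookkeeping)] -/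
def dressedSlotsOfRecord₁₃ (θ : Stage13Params F N) (hP : θ.Provisos₁₃ F N) (g₀ : ℕ → ℝ) (os : List (ULoop F)) (t : ℝ) :
    TexpAOfRecord F N θ.ν θ.τ9.M :=
  dressedSlotsOfDatum₉ F N θ.toStage9Params (datumOfRecord₁₃ F N θ hP) g₀ os t

/-- Face (`rfl`): the record's dressed slots are the Stage-9-started ones at its own datum. [cite: Balaban1989LargeFieldII, Thm 1 p.355 (bookkeeping)] -/
theorem dressedSlotsOfRecord₁₃_eq (θ : Stage13Params F N) (hP : θ.Provisos₁₃ F N) (g₀ : ℕ → ℝ) (os : List (ULoop F)) (t : ℝ) :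
    dressedSlotsOfRecord₁₃ F N θ hP g₀ os t = dressedSlotsOfDatum₉ F N θ.toStage9Params (datumOfRecord₁₃ F N θ hP) g₀ os t := rfl

/-- Level 0 of the record's dressed slots IS the dressed start of its datum (`rfl`). [cite: Balaban1988Convergent, (2.18) p.257 (bookkeeping)] -/
theorem dressedSlotsOfRecord₁₃_zero (θ : Stage13Params F N) (hP : θ.Provisos₁₃ F N) (g₀ : ℕ → ℝ) (os : List (ULoop F)) (t : ℝ)
    (p : B12.RunParams) (g : ℕ → ℝ) (s : SeqOfRecord F θ.ν θ.τ9.M g p.K 0) :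
    dressedSlotsOfRecord₁₃ F N θ hP g₀ os t p g 0 s = dressedStart F N (datumOfRecord₁₃ F N θ hP) g₀ os t p := rfl

/-- **THE DRESSED DENSITIES OF RECORD, STAGE 13** (the (2.18) assembly of the record's dressed slots over its own sequence index).
[cite: Balaban1988Convergent, (2.18) p.257; Balaban1989LargeFieldII, Thm 1 p.355 (bookkeeping)] -/
def dressedDensityOfRecord₁₃ (θ : Stage13Params F N) (hP : θ.Provisos₁₃ F N) (g₀ : ℕ → ℝ) (os : List (ULoop F)) (t : ℝ)
    (p : B12.RunParams) (g : ℕ → ℝ) (k : ℕ) : Density (F.P p.K) k (SU N) :=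
  dressedDensityOfDatum₉ F N θ.toStage9Params (datumOfRecord₁₃ F N θ hP) g₀ os t p g k

/-- At step 0 the record's dressed density IS the dressed start of its datum. [cite: Balaban1988Convergent, (2.18) p.257, Thm 1 p.262 (bookkeeping)] -/
theorem dressedDensityOfRecord₁₃_zero (θ : Stage13Params F N) (hP : θ.Provisos₁₃ F N) (g₀ : ℕ → ℝ) (os : List (ULoop F)) (t : ℝ)
    (p : B12.RunParams) (g : ℕ → ℝ) :
    dressedDensityOfRecord₁₃ F N θ hP g₀ os t p g 0 = dressedStart F N (datumOfRecord₁₃ F N θ hP) g₀ os t p :=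
  dressedDensityOfDatum₉_zero F N θ.toStage9Params _ g₀ os t p g

/-- **E1 AT LEVEL 0 AT THE STAGE-13 RECORD**: the record's dressed density at step 0 integrates to the dressed partition function
`schemeZ ((datumOfRecord₁₃ F N θ hP).scheme g₀) os p.K t` of its own datum's Wilson scheme — no hypothesis. [cite: Balaban1985UV3, (6) p.257; King1986, (3.10) p.656 (bookkeeping)] -/
theorem integral_dressedDensityOfRecord₁₃_zero (θ : Stage13Params F N) (hP : θ.Provisos₁₃ F N) (g₀ : ℕ → ℝ) (os : List (ULoop F)) (t : ℝ)
    (p : B12.RunParams) (g : ℕ → ℝ) :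
    ∫ V, dressedDensityOfRecord₁₃ F N θ hP g₀ os t p g 0 V ∂fieldMeasure (F.P p.K) 0 (SU N) =
      T4GenFunBounds.schemeZ ((datumOfRecord₁₃ F N θ hP).scheme g₀) os p.K t :=
  integral_dressedDensityOfDatum₉_zero F N θ.toStage9Params _ g₀ os t p g

/-- **THE CLASS WEIGHTS OF RECORD, STAGE 13** (`D := datumOfRecord₁₃ F N θ hP`): run A's term weight of one sequence of record at the source `t`.
[cite: Balaban1988Convergent, (2.18) p.257; King1986, (3.10) p.656 (bookkeeping)] -/
def classWeightOfRecord₁₃ (θ : Stage13Params F N) (hP : θ.Provisos₁₃ F N) (g₀ : ℕ → ℝ) (os : List (ULoop F)) (p : B12.RunParams)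
    (g : ℕ → ℝ) (k : ℕ) (t : ℝ) (s : SeqOfRecord F θ.ν θ.τ9.M g p.K k) : ℝ :=
  classWeightOfDatum₉ F N θ.toStage9Params (datumOfRecord₁₃ F N θ hP) g₀ os p g k t s

/-- **E1 AT LEVEL 0 AS A SUM IDENTITY, AT THE STAGE-13 RECORD, NO HYPOTHESIS**: the class weights of the (length-0) sequences of record sum to the dressed
partition function `schemeZ ((datumOfRecord₁₃ F N θ hP).scheme g₀) os p.K t` (integrability at level 0 by `integrable_dressedStart_datumOfRecord₁₃`, `χ_0 ≡ 1`)
— the ₁₃ twin of `sum_classWeightOfRecord₁₂_zero`. [cite: Balaban1985UV3, (6) p.257; King1986, (3.10) p.656 (bookkeeping)] -/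
theorem sum_classWeightOfRecord₁₃_zero (θ : Stage13Params F N) (hP : θ.Provisos₁₃ F N) (g₀ : ℕ → ℝ) (os : List (ULoop F)) (t : ℝ)
    (p : B12.RunParams) (g : ℕ → ℝ) :
    ∑ s : SeqOfRecord F θ.ν θ.τ9.M g p.K 0, classWeightOfRecord₁₃ F N θ hP g₀ os p g 0 t s =
      T4GenFunBounds.schemeZ ((datumOfRecord₁₃ F N θ hP).scheme g₀) os p.K t :=
  sum_classWeightOfDatum₉_zero F N θ.toStage9Params _ (isPrintedAveraged_datumOfRecord₁₃ F N θ hP).avgMeasurable g₀ os t p g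

end Literature.MathematicalPhysics.QuantumFieldTheory.Balaban1983to89.Node00

end
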